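import Mathlib
import HarnessLib
import Summits.ValiantsHypothesis.ValiantsHypothesis.Theorems.KPlusLogSqLawWeakLiftingTowerGraftWronskianKFourAlternating

/-!
# Tower graft line — CONJECTURE W AT `K = 4`: SUPPORT REFLECTION AND THE REDUCTION TO THE FULLY ALTERNATING CELL

Helper file for LINE (B) `Cruxes/WeakLifting/Lines/tower_graft.lean` (crux `WeakLifting` = stmt-ValiantsHypothesis-19561).  NO stub is
claimed.  Hand g10 (`…WronskianKFourAlternating`) proved: on the orientation `d₀ + d₃ < d₁ + d₂` five positive zeros of `W(u,v)` force
the fully alternating Plücker cell, «the other orientation is the mirror image under support reflection», and the balanced case is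
`≤ 4` (`…WronskianDevelopable.card_posRoots_wronskian_le_four_of_balanced`).  This file supplies the mirror in the kernel and the
resulting reduction BY NAME:

* `eval_fewnomial_reverse_inv` — for `x > 0`, `(Σ cᵢ X^{E−eᵢ})(x⁻¹) = (Σ cᵢ X^{eᵢ})(x) / x^E`;
* `card_posRoots_fewnomial_le_reverse` — hence `#Z₊(Σ cᵢ X^{eᵢ}) ≤ #Z₊(Σ cᵢ X^{E−eᵢ})` (`x ↦ x⁻¹`);
* `X_mul_wronskian_reflect_eq` — for the reflected data `ũₗ = u_{3−l}`, `d̃ₗ = D − d_{3−l}`: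
  `X·W(ũ,ṽ) = −Σₐ Σ_b uₐv_b(d_b − dₐ) X^{2D − (dₐ+d_b)}`, the reversal (up to sign) of the pair-sum form of `X·W(u,v)`;
* ★ `card_posRoots_wronskian_le_reflect` — `#Z₊(W(u,v)) ≤ #Z₊(W(ũ,ṽ))`;
* ★★ `card_posRoots_wronskian_four_le_four_of_cellLaw` — CONJECTURE W AT `K = 4` FOLLOWS FROM THE CELL LAW: if `Z₊ ≤ 4` holds for all
  data on the orientation `d₀ + d₃ < d₁ + d₂` with the fully alternating Plücker pattern, then `Z₊(W(u,v)) ≤ 4` for ALL pairs of real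
  `4`-nomials on a common support.

HONEST FRAMING: the cell law itself is OPEN (memo `evidence-g11-conjectureW-K4-levels.md`, item evidence #41); nothing on S4/S4f/S5/S5ᴸ,
TowerB, `WeakLifting`, Conjecture B, `MatrixDescartes` (18050), `VP ≠ VNP`.  Def-free.  Seat: prover leafhand-val-kpluslogsqlaw-1 g11,
`--supports stmt-ValiantsHypothesis-19561 --as helper`.  [folklore: `x ↦ 1/x`; the packaging is this work]
-/

-- `Summit.ValiantsHypothesis.ValiantsHypothesis.…` repeats a component by the D-0017 layout
-- (single-conjunct summit), which the `dupNamespace` linter flags; the name is mandated.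
set_option linter.dupNamespace false
set_option autoImplicit false

namespace Summit.ValiantsHypothesis.ValiantsHypothesis.Theorems.KPlusLogSqLaw.TowerGraft

open Polynomial Finset
open scoped BigOperators Polynomial

namespace WronskianDevelopable

/-! ## §1 Reversal of a fewnomial and the map `x ↦ x⁻¹` -/

/-- evaluation of a general fewnomial (any finite index type). [folklore] -/
theorem eval_fewnomial' {ι : Type*} [Fintype ι] (c : ι → ℝ) (e : ι → ℕ) (x : ℝ) :
    (∑ i, C (c i) * (X : ℝ[X]) ^ e i).eval x = ∑ i, c i * x ^ e i := by
  simp [eval_finsetSum]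

/-- **reversal identity**: for `x ≠ 0` and `eᵢ ≤ E`, `(Σ cᵢ X^{E−eᵢ})(x⁻¹) = (Σ cᵢ X^{eᵢ})(x) / x^E`. [folklore] -/
theorem eval_fewnomial_reverse_inv {ι : Type*} [Fintype ι] (c : ι → ℝ) (e : ι → ℕ) (E : ℕ) (hE : ∀ i, e i ≤ E)
    {x : ℝ} (hx : x ≠ 0) :
    (∑ i, C (c i) * (X : ℝ[X]) ^ (E - e i)).eval x⁻¹ = (∑ i, C (c i) * (X : ℝ[X]) ^ e i).eval x / x ^ E := by
  rw [eval_fewnomial', eval_fewnomial', Finset.sum_div]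
  refine Finset.sum_congr rfl fun i _ => ?_
  have hxE : x ^ E ≠ 0 := pow_ne_zero E hx
  have key : x⁻¹ ^ (E - e i) = x ^ e i / x ^ E := by
    rw [inv_pow, eq_div_iff hxE, ← pow_sub_mul_pow x (hE i), ← mul_assoc, inv_mul_cancel₀ (pow_ne_zero _ hx), one_mul]
  rw [key, mul_div_assoc]

/-- **`#Z₊` does not drop under reversal**: `x ↦ x⁻¹` injects the positive roots of `Σ cᵢ X^{eᵢ}` into those of `Σ cᵢ X^{E−eᵢ}`.
[folklore] -/
theorem card_posRoots_fewnomial_le_reverse {ι : Type*} [Fintype ι] (c : ι → ℝ) (e : ι → ℕ) (E : ℕ) (hE : ∀ i, e i ≤ E) :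
    ((∑ i, C (c i) * (X : ℝ[X]) ^ e i).roots.toFinset.filter (fun x => 0 < x)).card ≤
      ((∑ i, C (c i) * (X : ℝ[X]) ^ (E - e i)).roots.toFinset.filter (fun x => 0 < x)).card := by
  classical
  set P : ℝ[X] := ∑ i, C (c i) * (X : ℝ[X]) ^ e i with hP
  set Q : ℝ[X] := ∑ i, C (c i) * (X : ℝ[X]) ^ (E - e i) with hQ
  by_cases hP0 : P = 0
  · simp [hP0]
  -- `Q ≠ 0`: otherwise `P` vanishes on `(0,∞)`
  have hQ0 : Q ≠ 0 := by
    intro hQz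
    apply hP0
    apply Polynomial.eq_zero_of_infinite_isRoot
    apply Set.infinite_of_not_bddAbove
    intro hbdd
    obtain ⟨M, hM⟩ := hbdd
    have hmem : max M 0 + 1 ∈ {x | P.IsRoot x} := by
      have hx : (0 : ℝ) < max M 0 + 1 := by have := le_max_right M 0; linarith
      have h := eval_fewnomial_reverse_inv c e E hE (ne_of_gt hx)
      rw [← hQ, hQz, eval_zero] at h
      have hxE : (max M 0 + 1) ^ E ≠ 0 := pow_ne_zero E (ne_of_gt hx)
      show P.eval (max M 0 + 1) = 0
      rw [hP]
      have := h.symm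
      rwa [div_eq_zero_iff, or_iff_left hxE] at this
    have := hM hmem
    have := le_max_left M 0
    linarith
  refine Finset.card_le_card_of_injOn (fun x => x⁻¹) (fun x hx => ?_) (fun x hx y hy hxy => by simpa using hxy)
  rw [Finset.mem_coe, Finset.mem_filter, Multiset.mem_toFinset, mem_roots hP0] at hx
  rw [Finset.mem_coe, Finset.mem_filter, Multiset.mem_toFinset, mem_roots hQ0]
  refine ⟨?_, inv_pos.mpr hx.2⟩
  show Q.eval x⁻¹ = 0
  rw [hQ, eval_fewnomial_reverse_inv c e E hE (ne_of_gt hx.2), ← hP]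
  rw [show P.eval x = 0 from hx.1, zero_div]

/-! ## §2 The reflected support -/

/-- the pair-sum form of `X·W` over the product index type. [folklore] -/
theorem X_mul_wronskian_fewnomial_eq_prod {K : ℕ} (u v : Fin K → ℝ) (d : Fin K → ℕ) :
    (X : ℝ[X]) * wronskian (∑ l, C (u l) * (X : ℝ[X]) ^ d l) (∑ l, C (v l) * (X : ℝ[X]) ^ d l) =
      ∑ ab : Fin K × Fin K, C (u ab.1 * v ab.2 * ((d ab.2 : ℝ) - d ab.1)) * (X : ℝ[X]) ^ (d ab.1 + d ab.2) := by
  rw [InflectionLaw.X_mul_wronskian_fewnomial_eq, ← Finset.univ_product_univ, Finset.sum_product]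

/-- **`X·W` of the reflected data is (minus) the reversal of the pair-sum form**: with `ũₗ = u (rev l)`, `d̃ₗ = D − d (rev l)`:
`X·W(ũ,ṽ) = −Σ_{(a,b)} uₐ v_b (d_b − dₐ) X^{2D − (dₐ + d_b)}`. [this work] -/
theorem X_mul_wronskian_reflect_eq {K : ℕ} (u v : Fin K → ℝ) (d : Fin K → ℕ) (D : ℕ) (hD : ∀ l, d l ≤ D) :
    (X : ℝ[X]) * wronskian (∑ l, C (u (Fin.rev l)) * (X : ℝ[X]) ^ (D - d (Fin.rev l)))
        (∑ l, C (v (Fin.rev l)) * (X : ℝ[X]) ^ (D - d (Fin.rev l))) =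
      -∑ ab : Fin K × Fin K, C (u ab.1 * v ab.2 * ((d ab.2 : ℝ) - d ab.1)) * (X : ℝ[X]) ^ (2 * D - (d ab.1 + d ab.2)) := by
  rw [X_mul_wronskian_fewnomial_eq_prod]
  -- reindex by `(a,b) ↦ (rev a, rev b)`
  have hre : ∑ ab : Fin K × Fin K, C (u (Fin.rev ab.1) * v (Fin.rev ab.2) * (((D - d (Fin.rev ab.2) : ℕ) : ℝ) - ((D - d (Fin.rev ab.1) : ℕ) : ℝ))) *
        (X : ℝ[X]) ^ ((D - d (Fin.rev ab.1)) + (D - d (Fin.rev ab.2))) =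
      ∑ ab : Fin K × Fin K, C (u ab.1 * v ab.2 * (((D - d ab.2 : ℕ) : ℝ) - ((D - d ab.1 : ℕ) : ℝ))) *
        (X : ℝ[X]) ^ ((D - d ab.1) + (D - d ab.2)) := by
    refine Fintype.sum_equiv ((Fin.revPerm).prodCongr (Fin.revPerm)) _ _ (fun ab => ?_)
    simp [Fin.revPerm_apply]
  rw [hre, ← Finset.sum_neg_distrib]
  refine Finset.sum_congr rfl fun ab _ => ?_
  have h1 := hD ab.1
  have h2 := hD ab.2
  have hexp : (D - d ab.1) + (D - d ab.2) = 2 * D - (d ab.1 + d ab.2) := by omega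
  rw [hexp, Nat.cast_sub h1, Nat.cast_sub h2, ← neg_mul, ← map_neg C]
  congr 2
  ring

/-- the reflected exponents stay below `2D` pairwise. [folklore] -/
theorem pairSum_le_two_mul {K : ℕ} (d : Fin K → ℕ) (D : ℕ) (hD : ∀ l, d l ≤ D) (ab : Fin K × Fin K) :
    d ab.1 + d ab.2 ≤ 2 * D := by
  have := hD ab.1; have := hD ab.2; omega

/-- ★ **reflection does not decrease `#Z₊(W)`**: `#Z₊(W(u,v)) ≤ #Z₊(W(ũ,ṽ))` for the reflected data. [this work] -/
theorem card_posRoots_wronskian_le_reflect {K : ℕ} (u v : Fin K → ℝ) (d : Fin K → ℕ) (D : ℕ) (hD : ∀ l, d l ≤ D) :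
    ((wronskian (∑ l, C (u l) * (X : ℝ[X]) ^ d l) (∑ l, C (v l) * (X : ℝ[X]) ^ d l)).roots.toFinset.filter
        (fun x => 0 < x)).card ≤
      ((wronskian (∑ l, C (u (Fin.rev l)) * (X : ℝ[X]) ^ (D - d (Fin.rev l)))
          (∑ l, C (v (Fin.rev l)) * (X : ℝ[X]) ^ (D - d (Fin.rev l)))).roots.toFinset.filter (fun x => 0 < x)).card := by
  classical
  rw [← InflectionLaw.card_posRoots_X_mul, X_mul_wronskian_fewnomial_eq_prod]
  rw [← InflectionLaw.card_posRoots_X_mul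
    (wronskian (∑ l, C (u (Fin.rev l)) * (X : ℝ[X]) ^ (D - d (Fin.rev l))) _), X_mul_wronskian_reflect_eq u v d D hD,
    roots_neg]
  exact card_posRoots_fewnomial_le_reverse _ _ (2 * D) (pairSum_le_two_mul d D hD)

/-! ## §3 Conjecture W at `K = 4` follows from the cell law -/

/-- ★★ **THE REDUCTION.**  If `Z₊(W) ≤ 4` for all data on the orientation `d₀ + d₃ < d₁ + d₂` lying in the fully alternating Plücker
cell, then `Z₊(W(u,v)) ≤ 4` for every pair of real `4`-nomials on a common strictly increasing support. [this work] -/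
theorem card_posRoots_wronskian_four_le_four_of_cellLaw
    (H : ∀ (u v : Fin 4 → ℝ) (d : Fin 4 → ℕ), StrictMono d → d 0 + d 3 < d 1 + d 2 →
      (u 0 * v 1 - u 1 * v 0) * (u 0 * v 2 - u 2 * v 0) < 0 → (u 0 * v 2 - u 2 * v 0) * (u 0 * v 3 - u 3 * v 0) < 0 →
      (u 0 * v 3 - u 3 * v 0) * (u 1 * v 2 - u 2 * v 1) < 0 → (u 1 * v 2 - u 2 * v 1) * (u 1 * v 3 - u 3 * v 1) < 0 →
      (u 1 * v 3 - u 3 * v 1) * (u 2 * v 3 - u 3 * v 2) < 0 →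
      ((wronskian (∑ l, C (u l) * (X : ℝ[X]) ^ d l) (∑ l, C (v l) * (X : ℝ[X]) ^ d l)).roots.toFinset.filter
        (fun x => 0 < x)).card ≤ 4)
    (u v : Fin 4 → ℝ) (d : Fin 4 → ℕ) (hd : StrictMono d) :
    ((wronskian (∑ l, C (u l) * (X : ℝ[X]) ^ d l) (∑ l, C (v l) * (X : ℝ[X]) ^ d l)).roots.toFinset.filter
      (fun x => 0 < x)).card ≤ 4 := by
  -- orientation A: either `≤ 4` outright or the cell is forced and `H` applies
  have caseA : ∀ (u v : Fin 4 → ℝ) (d : Fin 4 → ℕ), StrictMono d → d 0 + d 3 < d 1 + d 2 →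
      ((wronskian (∑ l, C (u l) * (X : ℝ[X]) ^ d l) (∑ l, C (v l) * (X : ℝ[X]) ^ d l)).roots.toFinset.filter
        (fun x => 0 < x)).card ≤ 4 := by
    intro u v d hd hA
    by_contra hgt
    have h5 : 5 ≤ ((wronskian (∑ l, C (u l) * (X : ℝ[X]) ^ d l) (∑ l, C (v l) * (X : ℝ[X]) ^ d l)).roots.toFinset.filter
        (fun x => 0 < x)).card := by omega
    obtain ⟨c1, c2, c3, c4, c5⟩ := plucker_alternating_of_five_le u v d hd hA h5
    have := H u v d hd hA c1 c2 c3 c4 c5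
    omega
  rcases lt_trichotomy (d 0 + d 3) (d 1 + d 2) with hA | hbal | hB
  · exact caseA u v d hd hA
  · exact card_posRoots_wronskian_le_four_of_balanced u v d hbal
  · -- orientation B: reflect the support about `D = d 3`
    set D : ℕ := d 3 with hDdef
    have hD : ∀ l, d l ≤ D := fun l => hd.monotone (Fin.le_last l)
    refine (card_posRoots_wronskian_le_reflect u v d D hD).trans ?_
    refine caseA (fun l => u (Fin.rev l)) (fun l => v (Fin.rev l)) (fun l => D - d (Fin.rev l)) ?_ ?_
    · -- strictly increasing
      intro i j hij
      have hrev : Fin.rev j < Fin.rev i := Fin.rev_lt_rev.mpr hij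
      have h1 := hd hrev
      have h2 := hD (Fin.rev i)
      show D - d (Fin.rev i) < D - d (Fin.rev j)
      omega
    · -- orientation flips
      show (D - d (Fin.rev 0)) + (D - d (Fin.rev 3)) < (D - d (Fin.rev 1)) + (D - d (Fin.rev 2))
      have r0 : Fin.rev (0 : Fin 4) = 3 := by decide
      have r1 : Fin.rev (1 : Fin 4) = 2 := by decide
      have r2 : Fin.rev (2 : Fin 4) = 1 := by decide
      have r3 : Fin.rev (3 : Fin 4) = 0 := by decide
      rw [r0, r1, r2, r3]
      have := hD 0; have := hD 1; have := hD 2; have := hD 3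
      omega

end WronskianDevelopable

end Summit.ValiantsHypothesis.ValiantsHypothesis.Theorems.KPlusLogSqLaw.TowerGraft
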